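import Summits.ResolutionOfSingularities.ResolutionOfSingularities.Theorems.EquisingularLiftEquisingularLiftNatCompleteIntersectionLiftNose
import Summits.ResolutionOfSingularities.ResolutionOfSingularities.Theorems.EquisingularLiftEquisingularLiftNatDeterminantalLiftAlgebra
import Literature.AlgebraicGeometry.Motives.SegreEmbedding
import HarnessLib

/-!
# [OURS · L1 W4.5(b) · EL♮(3)] T-DET-PROJ, part 2 (THE DETERMINANTAL NOSE): the lift `C = I_t(M̃)~ ⊂ ℙⁿ_O` of a SMOOTH determinantal
# `Σ = V₊(I_t(M)) ⊂ ℙⁿ_k` (maximal minors of a `(t+1) × t` matrix of forms) is a REGULAR scheme, FLAT over `Spec O`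

Cell `res-hironaka`, rung L, slot W4.5(b); crux **EL♮(3)** (stmt-ResolutionOfSingularities-20148), rung v6′ «DET-nose» (res-L1-w45b-lead-2
LEAD-MEMO-5 §B; plan AGREED 2026-08-27T09:57:46Z: «route = Eagon–Northcott height bound upstairs ⇒ I_t(M̃)_x = (Δ̃ᵢ, Δ̃ⱼ)_x at each special
point ⇒ pv-027's `CILift.isRegular_and_flat_of_cotangentLift` with c = 2 verbatim»). OURS; NOT a statement of any manuscript; AI-written,
weaker than expert review. No definition, no `sorry`, standard axioms. `--supports stmt-ResolutionOfSingularities-20148 --as helper`.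
Part 1 = `…NatDeterminantalLiftAlgebra` (ring core `DetLift.exists_cotangentLift_of_pair`). PATTERN (adapted, cited): res-D-pv-027 AS
res-L1-s36-pv-4's T-LIFT-CI part 4 `CILift.isRegular_and_flat_ciNose` (p520182) — the complete-intersection nose; here the global
complete intersection is replaced by the determinantal ideal and the LOCAL complete intersection is a point-dependent PAIR of maximal minors.

* `mk₁_eq_eval₂Hom_frac` — on the chart `D₊(x_i)` the dehomogenised form `f/x_iᵈ` is the image of `f` under the DEHOMOGENISATION RING
  HOMOMORPHISM `ψ_i : O[x] → (O[x]_{x_i})₀`, `x_j ↦ x_j/x_i` (tree `Segre.awayMk_eq_eval₂`); hence dehomogenising commutes with determinants: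
  `stalkIdeal_projIdealSheaf_rowMinors` — **the stalk of `I_t(M̃)~` at a point of `D₊(x_i)` is the determinantal ideal `I_t(m)` of the GERM
  MATRIX `m = germ ∘ ψ_i (M̃)`** (pv-027 `CILift.stalkIdeal_projIdealSheaf_span` + `RingHom.map_det` + part 1 `minorsIdeal_eq_span_rowMinors`).
* `stalkMap_germ_varpi_eq_zero` — along the closed immersion `g = Proj φ : ℙⁿ_k → ℙⁿ_O` of the special fibre the stalk map kills the
  uniformiser (`g ≫ q = q_k ≫ Spec π`, `π ϖ = 0`; the inline step of p520182 exported as a lemma).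
* **`isRegular_and_flat_detNose`** — `O` a DVR with uniformiser `ϖ`, `π : O ↠ k` onto a field with `π ϖ = 0`, `φ` the graded coefficient
  map, `M̃` a `(t+1) × t` matrix over `O[x₀..xₙ]` whose row-deleted maximal minors `Δ̃ᵢ = det (M̃ minus row i)` are forms of degrees `Dᵢ`,
  `M = π(M̃)` entrywise (so `Δᵢ := det (M minus row i) = π Δ̃ᵢ`). HYPOTHESIS (J′-pair) = «`Σ = V₊(Δ₀,…,Δ_t)` is SMOOTH OF CODIMENSION 2»,
  chartwise and stalk-level as in p520182: at every point `y` of `supp (Δ)~` some standard chart `D₊(x_i) ∋ y` and some PAIR `a, b` of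
  maximal minors have «`c_a·germ_y(Δ_a/x_i^{D_a}) + c_b·germ_y(Δ_b/x_i^{D_b}) ∈ 𝔪_y² ⇒ c_a, c_b ∈ 𝔪_y`» (independent differentials; from
  the registered Jacobian-pair clause by Euler's identity — the (J) ⇒ (J′) brick, shared with the CI nose). CONCLUSION: `V(I_t(M̃)~)` is a
  REGULAR scheme and `V(I_t(M̃)~) → ℙⁿ_O → Spec O` is FLAT — clauses (b), (c) of the HorizChainE1 nose step. At a special point `g y`:
  `𝒪_{ℙⁿ_O, g y}` regular with `ϖ ∉ 𝔪²` (`stub_goodAtOfSmooth`); the stalk is `I_t(m)` (above); the pair of germs of lifted minors lies in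
  `I_t(m) ∩ 𝔪` and inherits the downstairs hypothesis along the surjective stalk map of `g` (pv-027 `CILift.downstairs_of_surjective`,
  `stalkMap_germ_mk₁`); part 1 `DetLift.exists_cotangentLift_of_pair` (Eagon–Northcott) turns this into the hypothesis of
  `CILift.isRegular_and_flat_of_cotangentLift`. No Hilbert–Burch complex is used.

What remains for the v6′ instance (stated plainly, same list as the CI nose): the SMOOTH upgrade of (b)+(c) (res-type-051's T4 route, flat +
regular fibres, Literature 01V8), the hKEY clause «`(Δ)~ = vanishingIdeal ⟨Σ,_⟩`» (stalkwise: `I_t(M)_y = (Δ_a, Δ_b)_y` prime — the same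
Eagon–Northcott argument downstairs), the existence of a homogeneous lift `M̃` of a given `M`, and the (J) ⇒ (J′) brick.

References: H. Matsumura, *Commutative Ring Theory* (1986), Thm. 13.10, Thms. 14.2–14.3 [Matsumura1987]; R. Hartshorne, *Algebraic Geometry*
(1977), II Prop. 5.9, III Prop. 9.7 [Hartshorne1977]; Q. Liu (2002), Prop. 3.1.9 [Liu2002]; cell: LEAD-MEMO-5 §B, res-type-097 PLAN
2026-08-27T09:56:24Z / lead-2 09:57:46Z (OURS).
-/

set_option linter.dupNamespace false -- mandated namespace `Summit.<Summit>.<Problem>` of this single-conjunct summit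
set_option linter.overlappingInstances false -- signatures carry `[IsDomain O] [IsDiscreteValuationRing O]`

noncomputable section

open CategoryTheory AlgebraicGeometry TopologicalSpace IsLocalRing Opposite
open MvPolynomial HomogeneousLocalization
open Literature.AlgebraicGeometry.Resolution
open Literature.RingTheory.KrullDimension
open Summit.ResolutionOfSingularities.ResolutionOfSingularities.Cruxes.EquisingularLift.StrataSplit

attribute [local instance] MvPolynomial.gradedAlgebra

namespace Summit.ResolutionOfSingularities.ResolutionOfSingularities.Cruxes.EquisingularLiftNat.Sections

namespace DetLift

/-! ## §1 Dehomogenisation is a ring homomorphism; the stalk of `I_t(M̃)~` is `I_t` of the germ matrix -/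

section Dehomogenise

variable {R : Type} [CommRing R] {n : ℕ}

/-- **`f/x_iᵈ = ψ_i(f)`**: the dehomogenised form of a form `f` of degree `d` on the chart `D₊(x_i)` is the image of `f` under the ring
homomorphism `ψ_i = eval₂Hom cst (x_j ↦ x_j/x_i) : R[x₀..xₙ] → (R[x]_{x_i})₀`. (Tree `Segre.awayMk_eq_eval₂`, restated for the `mk₁` of the
Proj ideal-sheaf dictionary.) [folklore] -/
theorem mk₁_eq_eval₂Hom_frac (i : Fin (n + 1)) (d : ℕ) (f : MvPolynomial (Fin (n + 1)) R)
    (hf : f ∈ homogeneousSubmodule (Fin (n + 1)) R d) :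
    mk₁ (homogeneousSubmodule (Fin (n + 1)) R) (CILift.X_mem_one' i) d f hf =
      MvPolynomial.eval₂Hom (Literature.AlgebraicGeometry.Motives.Segre.cst R (X i))
        (Literature.AlgebraicGeometry.Motives.Segre.frac R i) f := by
  unfold mk₁
  exact Literature.AlgebraicGeometry.Motives.Segre.awayMk_eq_eval₂ R i d f _

variable {t : ℕ} (N : Matrix (Fin (t + 1)) (Fin t) (MvPolynomial (Fin (n + 1)) R))
  (F : Fin (t + 1) → MvPolynomial (Fin (n + 1)) R) (hFN : ∀ l, F l = (N.submatrix l.succAbove id).det)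
  (D : Fin (t + 1) → ℕ) (hF : ∀ l, F l ∈ homogeneousSubmodule (Fin (n + 1)) R (D l))

include hFN in
/-- **A row-deleted minor of the GERM MATRIX is the germ of the dehomogenised minor**: for `m := germ_x ∘ ψ_i (N)` (`ψ_i` the
dehomogenisation homomorphism on `D₊(x_i)`), `det (m minus row l) = germ_x (Δ_l / x_i^{D_l})` (`RingHom.map_det`). [folklore] -/
theorem det_germMatrix_submatrix (i : Fin (n + 1)) (x : Proj (homogeneousSubmodule (Fin (n + 1)) R))
    (hx : x ∈ Proj.basicOpen (homogeneousSubmodule (Fin (n + 1)) R) (X i)) (l : Fin (t + 1)) :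
    ((N.map ((((Proj (homogeneousSubmodule (Fin (n + 1)) R)).presheaf.germ
              (Proj.basicOpen (homogeneousSubmodule (Fin (n + 1)) R) (X i)) x hx).hom.comp
            (Proj.awayToSection (homogeneousSubmodule (Fin (n + 1)) R) (X i)).hom).comp
          (MvPolynomial.eval₂Hom (Literature.AlgebraicGeometry.Motives.Segre.cst R (X i))
            (Literature.AlgebraicGeometry.Motives.Segre.frac R i)))).submatrix l.succAbove id).det =
      ((Proj (homogeneousSubmodule (Fin (n + 1)) R)).presheaf.germ
          (Proj.basicOpen (homogeneousSubmodule (Fin (n + 1)) R) (X i)) x hx).hom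
        ((Proj.awayToSection (homogeneousSubmodule (Fin (n + 1)) R) (X i)).hom
          (mk₁ (homogeneousSubmodule (Fin (n + 1)) R) (CILift.X_mem_one' i) (D l) (F l) (hF l))) := by
  rw [Matrix.submatrix_map, ← RingHom.mapMatrix_apply, ← RingHom.map_det, ← hFN l, RingHom.comp_apply,
    RingHom.comp_apply, ← mk₁_eq_eval₂Hom_frac i (D l) (F l) (hF l)]

include hFN in
/-- **The stalk of the determinantal ideal sheaf is the determinantal ideal of the germ matrix.** For a `(t+1) × t` matrix `N` of
polynomials whose row-deleted maximal minors `F_l = Δ_l` are forms of degrees `D_l`, at a point `x ∈ D₊(x_i)`: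
`((Δ)~)_x = I_t(m)`, `m := germ_x ∘ ψ_i (N)` the germ matrix, where `(Δ)~ := projIdealSheaf ⟨(Δ₀,…,Δ_t), _⟩` and `I_t(m)` is the tree's
`minorsIdeal t m` (pv-027 `CILift.stalkIdeal_projIdealSheaf_span` + part 1 `minorsIdeal_eq_span_rowMinors`).
[cite: Hartshorne1977, II Prop. 5.9 (proof)] -/
theorem stalkIdeal_projIdealSheaf_rowMinors (i : Fin (n + 1)) (x : Proj (homogeneousSubmodule (Fin (n + 1)) R))
    (hx : x ∈ Proj.basicOpen (homogeneousSubmodule (Fin (n + 1)) R) (X i)) :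
    stalkIdeal (projIdealSheaf (homogeneousSubmodule (Fin (n + 1)) R)
        ⟨Ideal.span (Set.range F), isHomogeneous_span_of_forall_mem _ F D hF⟩) x =
      minorsIdeal t (N.map
        ((((Proj (homogeneousSubmodule (Fin (n + 1)) R)).presheaf.germ
              (Proj.basicOpen (homogeneousSubmodule (Fin (n + 1)) R) (X i)) x hx).hom.comp
            (Proj.awayToSection (homogeneousSubmodule (Fin (n + 1)) R) (X i)).hom).comp
          (MvPolynomial.eval₂Hom (Literature.AlgebraicGeometry.Motives.Segre.cst R (X i))
            (Literature.AlgebraicGeometry.Motives.Segre.frac R i)))) := by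
  rw [CILift.stalkIdeal_projIdealSheaf_span F D hF i x hx, minorsIdeal_eq_span_rowMinors]
  congr 1
  ext z
  simp only [Set.mem_range, det_germMatrix_submatrix N F hFN D hF i x hx]

end Dehomogenise

/-! ## §2 The stalk map of the special-fibre immersion kills the uniformiser -/

section Varpi

variable (O : Type) [CommRing O]

/-- **`g^♯(ϖ) = 0` on stalks**: for `π : O ↠ k` and the closed immersion `g = Proj φ : ℙⁿ_k → ℙⁿ_O` of the special fibre (`φ` the
coefficient map), the stalk map of `g` at `y` kills the germ at `g y` of the uniformiser `ϖ ∈ ker π` (because `g ≫ q = q_k ≫ Spec π`: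
`ℙⁿ_k = ℙⁿ_O ×_O k`, tree `ProjectiveAmbientFibre.isPullback_projMap`). The inline step of p520182, exported.
[cite: Liu2002, Prop. 3.1.9] -/
theorem stalkMap_germ_varpi_eq_zero {k : Type} [Field k] (π : O →+* k) (hπ : Function.Surjective π) (ϖ : O) (hπϖ : π ϖ = 0)
    {n : ℕ} (φ : (homogeneousSubmodule (Fin (n + 1)) O) →+*ᵍ (homogeneousSubmodule (Fin (n + 1)) k))
    (hφ' : HomogeneousIdeal.irrelevant (homogeneousSubmodule (Fin (n + 1)) k) ≤
      (HomogeneousIdeal.irrelevant (homogeneousSubmodule (Fin (n + 1)) O)).map φ)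
    (hφ : ∀ s, φ s = MvPolynomial.map π s) (y : Proj (homogeneousSubmodule (Fin (n + 1)) k)) :
    ((Proj.map φ hφ').stalkMap y).hom
        (((Proj (homogeneousSubmodule (Fin (n + 1)) O)).presheaf.Γgerm (Proj.map φ hφ' y)).hom
          ((Proj.toSpecZero (homogeneousSubmodule (Fin (n + 1)) O) ≫
              Spec.map (CommRingCat.ofHom (algebraMap O ((homogeneousSubmodule (Fin (n + 1)) O) 0)))).appTop.hom
            ((Scheme.ΓSpecIso (.of O)).inv.hom ϖ))) = 0 := by
  -- adapted from res-D-pv-027's `CILift.isRegular_and_flat_ciNose` (p520182), the «g kills ϖ» step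
  set q := Proj.toSpecZero (homogeneousSubmodule (Fin (n + 1)) O) ≫
    Spec.map (CommRingCat.ofHom (algebraMap O ((homogeneousSubmodule (Fin (n + 1)) O) 0))) with hq
  set g := Proj.map φ hφ' with hg
  have hP := ProjectiveAmbientFibre.isPullback_projMap π φ hφ hπ hφ'
  rw [stalkMap_Γgerm_apply' g y]
  set qk : Proj (homogeneousSubmodule (Fin (n + 1)) k) ⟶ Spec (.of k) :=
    Proj.toSpecZero (homogeneousSubmodule (Fin (n + 1)) k) ≫
      Spec.map (CommRingCat.ofHom (algebraMap k ((homogeneousSubmodule (Fin (n + 1)) k) 0))) with hqk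
  set sϖ : Γ(Spec (.of O), ⊤) := (Scheme.ΓSpecIso (.of O)).inv.hom ϖ with hsϖ
  have hw : g ≫ q = qk ≫ Spec.map (CommRingCat.ofHom π) := by rw [hg, hq, hqk]; exact hP.w
  have hcomp : g.appTop.hom (q.appTop.hom sϖ) = qk.appTop.hom ((Spec.map (CommRingCat.ofHom π)).appTop.hom sϖ) := by
    have h1 : g.appTop.hom (q.appTop.hom sϖ) = (g ≫ q).appTop.hom sϖ := rfl
    have h2 : qk.appTop.hom ((Spec.map (CommRingCat.ofHom π)).appTop.hom sϖ) =
        (qk ≫ Spec.map (CommRingCat.ofHom π)).appTop.hom sϖ := rfl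
    rw [h1, h2, hw]
  have h0 : (Spec.map (CommRingCat.ofHom π)).appTop.hom sϖ = 0 := by
    rw [hsϖ]
    have hnat := congrArg (fun ψ => ψ.hom ϖ) (Scheme.ΓSpecIso_inv_naturality (CommRingCat.ofHom π))
    simp only [CommRingCat.hom_comp, RingHom.comp_apply, CommRingCat.hom_ofHom] at hnat
    rw [← hnat, hπϖ, map_zero]
  rw [hcomp, h0, map_zero, map_zero]

end Varpi

/-! ## §3 The determinantal nose on `ℙⁿ_O` is REGULAR and `O`-FLAT -/

section Nose

variable (O : Type) [CommRing O] [IsDomain O] [IsDiscreteValuationRing O]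

/-- **T-DET-PROJ, centre clauses: the DETERMINANTAL NOSE `C = I_t(M̃)~ ⊂ ℙⁿ_O` over a SMOOTH `Σ = V₊(I_t(M))` IS A REGULAR SCHEME, FLAT
OVER `Spec O`.** `O` a DVR with uniformiser `ϖ`, `π : O ↠ k` onto a field with `π ϖ = 0`, `φ` the graded coefficient map (`φ s = map π s`);
`M̃` (`Mt`) a `(t+1) × t` matrix over `O[x₀..xₙ]` with `M = π M̃` entrywise, and NAMED families `Δ̃ = Δt`, `Δ` of their row-deleted
maximal minors (`hΔtdef`, `hΔdef`; naming them keeps `det` out of unification), forms of degrees `D_l`. HYPOTHESIS (J′-pair) («`Σ` smooth of codimension 2», stalk level, chartwise): at every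
point `y` of the support of `(Δ)~ = I_t(M)~` there are a standard chart `D₊(x_i) ∋ y` and a pair `a, b` of maximal minors with
«`c₀·germ_y(Δ_a/x_i^{D_a}) + c₁·germ_y(Δ_b/x_i^{D_b}) ∈ 𝔪_y² ⇒ c₀, c₁ ∈ 𝔪_y`». CONCLUSION: clauses (b) «`V(C)` regular» and (c)
«`V(C) → ℙⁿ_O → Spec O` flat». Proof = pv-027's `CILift.isRegular_and_flat_of_cotangentLift` fed, at each special point `g y`, by part 1's
`DetLift.exists_cotangentLift_of_pair` (Eagon–Northcott) on the germ matrix (`stalkIdeal_projIdealSheaf_rowMinors`), the pair's downstairs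
hypothesis being transported along the surjective stalk map of `g` (`CILift.downstairs_of_surjective`, `CILift.stalkMap_germ_mk₁`,
`stalkMap_germ_varpi_eq_zero`). Pattern adapted from p520182 (cited).
[cite: Matsumura1987, Thm. 13.10 and Thm. 14.2; Hartshorne1977, III Prop. 9.7; Liu2002, Prop. 3.1.9] -/
theorem isRegular_and_flat_detNose (ϖ : O) (hϖ : Irreducible ϖ) {k : Type} [Field k] (π : O →+* k)
    (hπ : Function.Surjective π) (hπϖ : π ϖ = 0) {n t : ℕ}
    (φ : (homogeneousSubmodule (Fin (n + 1)) O) →+*ᵍ (homogeneousSubmodule (Fin (n + 1)) k))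
    (hφ' : HomogeneousIdeal.irrelevant (homogeneousSubmodule (Fin (n + 1)) k) ≤
      (HomogeneousIdeal.irrelevant (homogeneousSubmodule (Fin (n + 1)) O)).map φ)
    (hφ : ∀ s, φ s = MvPolynomial.map π s)
    (Mt : Matrix (Fin (t + 1)) (Fin t) (MvPolynomial (Fin (n + 1)) O))
    (M : Matrix (Fin (t + 1)) (Fin t) (MvPolynomial (Fin (n + 1)) k))
    (hMtM : ∀ a b, MvPolynomial.map π (Mt a b) = M a b)
    (Δt : Fin (t + 1) → MvPolynomial (Fin (n + 1)) O) (Δ : Fin (t + 1) → MvPolynomial (Fin (n + 1)) k)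
    (hΔtdef : ∀ l, Δt l = (Mt.submatrix l.succAbove id).det) (hΔdef : ∀ l, Δ l = (M.submatrix l.succAbove id).det)
    (D : Fin (t + 1) → ℕ)
    (hΔt : ∀ l, Δt l ∈ homogeneousSubmodule (Fin (n + 1)) O (D l))
    (hΔ : ∀ l, Δ l ∈ homogeneousSubmodule (Fin (n + 1)) k (D l))
    (hJ : ∀ y ∈ (projIdealSheaf (homogeneousSubmodule (Fin (n + 1)) k)
        ⟨Ideal.span (Set.range Δ), isHomogeneous_span_of_forall_mem _ Δ D hΔ⟩).support,
      ∃ (i : Fin (n + 1)) (hyi : y ∈ Proj.basicOpen (homogeneousSubmodule (Fin (n + 1)) k) (X i)) (a b : Fin (t + 1)),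
        ∀ c : Fin 2 → (Proj (homogeneousSubmodule (Fin (n + 1)) k)).presheaf.stalk y,
          ∑ l, c l * ((Proj (homogeneousSubmodule (Fin (n + 1)) k)).presheaf.germ
              (Proj.basicOpen (homogeneousSubmodule (Fin (n + 1)) k) (X i)) y hyi).hom
            ((Proj.awayToSection (homogeneousSubmodule (Fin (n + 1)) k) (X i)).hom
              (mk₁ (homogeneousSubmodule (Fin (n + 1)) k) (CILift.X_mem_one' i) (D (![a, b] l))
                (Δ (![a, b] l)) (hΔ (![a, b] l)))) ∈
            maximalIdeal ((Proj (homogeneousSubmodule (Fin (n + 1)) k)).presheaf.stalk y) ^ 2 →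
          ∀ l, c l ∈ maximalIdeal ((Proj (homogeneousSubmodule (Fin (n + 1)) k)).presheaf.stalk y)) :
    Scheme.IsRegular (projIdealSheaf (homogeneousSubmodule (Fin (n + 1)) O)
        ⟨Ideal.span (Set.range Δt), isHomogeneous_span_of_forall_mem _ Δt D hΔt⟩).subscheme ∧
      Flat ((projIdealSheaf (homogeneousSubmodule (Fin (n + 1)) O)
          ⟨Ideal.span (Set.range Δt), isHomogeneous_span_of_forall_mem _ Δt D hΔt⟩).subschemeι ≫
        Proj.toSpecZero (homogeneousSubmodule (Fin (n + 1)) O) ≫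
          Spec.map (CommRingCat.ofHom (algebraMap O ((homogeneousSubmodule (Fin (n + 1)) O) 0)))) := by
  -- adapted from res-D-pv-027's `CILift.isRegular_and_flat_ciNose` (p520182): same skeleton, determinantal stalk step replaced
  set C := projIdealSheaf (homogeneousSubmodule (Fin (n + 1)) O)
    ⟨Ideal.span (Set.range Δt), isHomogeneous_span_of_forall_mem _ Δt D hΔt⟩ with hC
  set q := Proj.toSpecZero (homogeneousSubmodule (Fin (n + 1)) O) ≫
    Spec.map (CommRingCat.ofHom (algebraMap O ((homogeneousSubmodule (Fin (n + 1)) O) 0))) with hq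
  set g := Proj.map φ hφ' with hg
  have hφX : ∀ i : Fin (n + 1), φ (X i) = X i := fun i => by rw [hφ, map_X]
  have hΔtΔ : ∀ l, MvPolynomial.map π (Δt l) = Δ l := by
    intro l
    rw [hΔtdef, hΔdef, RingHom.map_det, RingHom.mapMatrix_apply, ← Matrix.submatrix_map]
    congr 1
    exact Matrix.ext fun a b => hMtM _ _
  have hφF : ∀ l, φ (Δt l) = Δ l := fun l => by rw [hφ, hΔtΔ]
  obtain ⟨hsm, hpr⟩ := stub_projectiveAmbientSmoothProper O n
  haveI : IsLocallyNoetherian (Proj (homogeneousSubmodule (Fin (n + 1)) O)) := by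
    haveI := hsm
    exact LocallyOfFiniteType.isLocallyNoetherian q
  haveI := hpr
  haveI : UniversallyClosed (C.subschemeι ≫ q) := inferInstance
  haveI : IsClosedImmersion g :=
    Literature.AlgebraicGeometry.FundamentalGroup.isClosedImmersion_projMap_of_surjective φ hφ'
      (fun s => by obtain ⟨u, hu⟩ := MvPolynomial.map_surjective π hπ s; exact ⟨u, (hφ u).trans hu⟩)
  refine CILift.isRegular_and_flat_of_cotangentLift O q C ϖ hϖ fun x hxC hx => ?_
  -- `x = g y` with `y ∈ supp (Δ)~`
  have hxr : x ∈ Set.range g := by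
    rw [hg, Summit.ResolutionOfSingularities.ResolutionOfSingularities.Cruxes.EquisingularLiftNat.LinearCentre.range_projMap_eq_specialFibre
      π hπ φ hφ hφ']
    exact hx
  obtain ⟨y, rfl⟩ := hxr
  have hy : y ∈ (projIdealSheaf (homogeneousSubmodule (Fin (n + 1)) k)
      ⟨Ideal.span (Set.range Δ), isHomogeneous_span_of_forall_mem _ Δ D hΔ⟩).support := by
    rw [← CILift.comap_projIdealSheaf_span φ hφ' hφX Δt Δ D hΔt hΔ hφF, Scheme.IdealSheafData.support_comap]
    exact hxC
  obtain ⟨i, hyi, a, b, hJy⟩ := hJ y hy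
  have hgyi : g y ∈ Proj.basicOpen (homogeneousSubmodule (Fin (n + 1)) O) (X i) := by
    change y ∈ g ⁻¹ᵁ Proj.basicOpen (homogeneousSubmodule (Fin (n + 1)) O) (X i)
    rw [hg, Proj.map_preimage_basicOpen, hφX]
    exact hyi
  obtain ⟨hreg, hgood⟩ := stub_goodAtOfSmooth O _ q hsm (g y)
  haveI := hreg
  refine ⟨hreg, hgood ϖ hϖ, ?_⟩
  -- the germ matrix `m` and the stalk `C_{g y} = I_t(m)`
  set hdeh : MvPolynomial (Fin (n + 1)) O →+* (Proj (homogeneousSubmodule (Fin (n + 1)) O)).presheaf.stalk (g y) :=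
    ((((Proj (homogeneousSubmodule (Fin (n + 1)) O)).presheaf.germ
          (Proj.basicOpen (homogeneousSubmodule (Fin (n + 1)) O) (X i)) (g y) hgyi).hom.comp
        (Proj.awayToSection (homogeneousSubmodule (Fin (n + 1)) O) (X i)).hom).comp
      (MvPolynomial.eval₂Hom (Literature.AlgebraicGeometry.Motives.Segre.cst O (X i))
        (Literature.AlgebraicGeometry.Motives.Segre.frac O i))) with hhdeh
  set m : Matrix (Fin (t + 1)) (Fin t) ((Proj (homogeneousSubmodule (Fin (n + 1)) O)).presheaf.stalk (g y)) :=
    Mt.map hdeh with hm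
  have hstalk : stalkIdeal C (g y) = minorsIdeal t m := by
    rw [hC, hm, hhdeh]
    exact stalkIdeal_projIdealSheaf_rowMinors Mt Δt hΔtdef D hΔt i (g y) hgyi
  -- the germs of the lifted pair
  set F : Fin 2 → (Proj (homogeneousSubmodule (Fin (n + 1)) O)).presheaf.stalk (g y) := fun l =>
    ((Proj (homogeneousSubmodule (Fin (n + 1)) O)).presheaf.germ
        (Proj.basicOpen (homogeneousSubmodule (Fin (n + 1)) O) (X i)) (g y) hgyi).hom
      ((Proj.awayToSection (homogeneousSubmodule (Fin (n + 1)) O) (X i)).hom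
        (mk₁ (homogeneousSubmodule (Fin (n + 1)) O) (CILift.X_mem_one' i) (D (![a, b] l)) (Δt (![a, b] l))
          (hΔt (![a, b] l)))) with hF
  have hFC : ∀ l, F l ∈ stalkIdeal C (g y) := by
    intro l
    rw [hC, CILift.stalkIdeal_projIdealSheaf_span Δt D hΔt i (g y) hgyi]
    exact Ideal.subset_span ⟨![a, b] l, rfl⟩
  have hle : stalkIdeal C (g y) ≤ maximalIdeal _ := (mem_support_iff_stalkIdeal_le C (g y)).mp hxC
  have hϖ𝔪 := CILift.germ_varpi_mem_maximalIdeal O q ϖ hϖ (g y) hx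
  -- the downstairs hypothesis for the pair, transported along the (surjective) stalk map of `g`
  have hdown : ∀ c : Fin 2 → (Proj (homogeneousSubmodule (Fin (n + 1)) O)).presheaf.stalk (g y),
      ∑ l, c l * F l ∈ maximalIdeal _ ^ 2 ⊔
        Ideal.span {((Proj (homogeneousSubmodule (Fin (n + 1)) O)).presheaf.Γgerm (g y)).hom
          (q.appTop.hom ((Scheme.ΓSpecIso (.of O)).inv.hom ϖ))} → ∀ l, c l ∈ maximalIdeal _ := by
    refine CILift.downstairs_of_surjective (g.stalkMap y).hom (g.stalkMap_surjective y) ?_ ?_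
    · rw [hg, hq]
      exact stalkMap_germ_varpi_eq_zero O π hπ ϖ hπϖ φ hφ' hφ y
    · intro c hc l
      have himg : ∀ l, (g.stalkMap y).hom (F l) =
          ((Proj (homogeneousSubmodule (Fin (n + 1)) k)).presheaf.germ
              (Proj.basicOpen (homogeneousSubmodule (Fin (n + 1)) k) (X i)) y hyi).hom
            ((Proj.awayToSection (homogeneousSubmodule (Fin (n + 1)) k) (X i)).hom
              (mk₁ (homogeneousSubmodule (Fin (n + 1)) k) (CILift.X_mem_one' i) (D (![a, b] l))
                (Δ (![a, b] l)) (hΔ (![a, b] l)))) := fun l =>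
        CILift.stalkMap_germ_mk₁ O φ hφ' i (hφX i) (D (![a, b] l)) (Δt (![a, b] l)) (hΔt (![a, b] l))
          (Δ (![a, b] l)) (hΔ (![a, b] l)) (hφF (![a, b] l)) y hyi hgyi
      simp only [himg] at hc
      exact hJy c hc l
  -- Eagon–Northcott (part 1): `I_t(m) = (F₀, F₁)`, in the hypothesis shape of the centre criterion
  obtain ⟨c, G, hmG, hG, hGdown⟩ := exists_cotangentLift_of_pair m hϖ𝔪 (hgood ϖ hϖ) (fun l => hle (hFC l)) hdown
    (fun l => hstalk ▸ hFC l) (hstalk ▸ hle)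
  exact ⟨c, G, hstalk.trans hmG, hG, hGdown⟩

end Nose

end DetLift

end Summit.ResolutionOfSingularities.ResolutionOfSingularities.Cruxes.EquisingularLiftNat.Sections

end
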